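import Mathlib
import Summits.NavierStokesRegularity.NavierStokesRegularity.Theorems.LerayQuarterDissipationFiniteDissipationLiouvilleCriticalProductionLaw
import Summits.NavierStokesRegularity.NavierStokesRegularity.Theorems.LerayQuarterDissipationFiniteDissipationLiouvilleCriticalProductionFarPast
import HarnessLib

/-!
# Route `LerayQuarterDissipation`, crux `FiniteDissipationLiouville` (stmt-NavierStokesRegularity-22144), line `birth` —
# THE BORDERLINE ROW IN THE FAR PAST: `t²|ω|²` sub-caloric on `(−∞, τ] × ℝ³` forces a finite-dissipation profile to vanish

Seat ns-lqd-lead g18 (LEAD of 22144, cell ns-idea-3; helper `--supports` 22144).  The all-time borderline row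
`…CriticalProductionLaw.eq_zero_of_enstrophy_subsolution_of_law` made EVENTUAL towards `t = −∞`, by the REGIONAL
hot spot of `…CriticalProductionFarPast` now carrying the dissipation law (translation- and scale-invariant, closed
under the class limits): for `a ≤ 1`,

* `curl_eq_zero_until_of_subsolution_until_of_law` — KNSS-gauge Type-I + law `∫|∇V(s)|² ≤ K/√(−s)` +
  `(−s)(⟪ω, DV ω⟫ − a|∇ω|²_F) ≤ |ω|²` on `(−∞, τ] × ℝ³` ⇒ `curl V ≡ 0` there (regional supremum renormalised to
  `(−1, 0)`, `t ≤ −1 ↦ t ≤ τ`; the limit carries law, bound and hypothesis on `t ≤ −1`; the strong maximum principle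
  on `[−2, −1] × ℝ³` with the maximum at the top gives `Q_W ≡ M > 0` on `[−2, −1) × ℝ³`, and the slice `t = −3/2`
  with `|curl W|² ≡ 4M/9` has infinite dissipation);
* **`eq_zero_of_enstrophy_subsolution_farPast_of_law`** — hence `V ≡ 0` on `t < 0` (KNSS Lemma 3.1 + constant
  slices on a past half-line, `…EndpointScheme.eq_zero_of_const_slices_until`);
* PORTRAIT `subsolution_fails_farPast_of_ne_zero` — a non-zero element of the crux's class 𝒟 has, for every
  `τ < 0` (and every `a ≤ 1`), a point `(s, y)` with `s ≤ τ` and `|ω|² < (−s)(⟪ω, DV ω⟫ − a|∇ω|²_F)`: the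
  super-caloric points of `t²|ω|²` RECEDE INTO THE FAR PAST (and accumulate at the apex of a singular element,
  `…CriticalProductionLawApex`).

WHAT THIS IS NOT: not a claim about Navier–Stokes regularity and not the crux — a Liouville-type stratum of the
portrait of the hypothetical minimal ancient element (bears_on LADDER-NS N0).
-/

noncomputable section

-- the summit and its single sub-problem share the name (CONVENTIONS §1), as in every Theorems file
set_option linter.dupNamespace false

namespace Summit.NavierStokesRegularity.NavierStokesRegularity.Theorems.FiniteDissipationLiouville.CriticalProduction

open MeasureTheory Set Function Filter Topology TopologicalSpace Metric InnerProductSpace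
open scoped RealInnerProductSpace InnerProductSpace Laplacian ContDiff ENNReal
open Literature.Analysis Literature.Analysis.FluidPDE
open Summit.NavierStokesRegularity.NavierStokesRegularity.Theorems
open Summit.NavierStokesRegularity.NavierStokesRegularity.Theorems.RecurrentReductionD
open Summit.NavierStokesRegularity.NavierStokesRegularity.Theorems.LocalSineTubeDoorProfileAlignedWindowRigidityAncient
open Summit.NavierStokesRegularity.NavierStokesRegularity.Theorems.PoloidalWindowDoorPoloidalWindowRigidityWindow
open Summit.NavierStokesRegularity.NavierStokesRegularity.Theorems.PoloidalWindowDoorPoloidalWindowRigidityClassRate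
open Summit.NavierStokesRegularity.NavierStokesRegularity.Theorems.LocalSineTubeDoorEnstrophyProductionProfileRigidity
open Summit.NavierStokesRegularity.NavierStokesRegularity.Theorems.PoloidalWindowDoorPoloidalWindowRigidityDegenerate
open Summit.NavierStokesRegularity.NavierStokesRegularity.Theorems.PoloidalWindowDoorPoloidalWindowRigidityFlat
open Summit.NavierStokesRegularity.NavierStokesRegularity.Theorems.PoloidalWindowDoorPoloidalWindowRigidityStrainRate
open Summit.NavierStokesRegularity.NavierStokesRegularity.Theorems.PoloidalWindowDoorPoloidalWindowRigidityPoloidalExtremal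
open Summit.NavierStokesRegularity.NavierStokesRegularity.Theorems.PoloidalWindowDoorPoloidalWindowRigidityEnstrophyHotSpot
open Summit.NavierStokesRegularity.NavierStokesRegularity.Theorems.PoloidalWindowDoorPoloidalWindowRigidityStrongMaxPrinciple
open Summit.NavierStokesRegularity.NavierStokesRegularity.Theorems.PoloidalWindowDoorPoloidalWindowRigidityCriticalProduction
open Summit.NavierStokesRegularity.NavierStokesRegularity.Theorems.FiniteDissipationLiouville.EndpointScheme

variable {C : ℝ} {V : ℝ → EuclideanSpace ℝ (Fin 3) → EuclideanSpace ℝ (Fin 3)}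

/-- **REGIONAL HOT SPOT CARRYING THE LAW.**  `a ≤ 1`, `IsTypeIAncientMild C V`, the dissipation law, and
`(−s)(⟪ω, DV ω⟫ − a|∇ω|²_F) ≤ |ω|²` on `(−∞, τ] × ℝ³` (`τ < 0`) ⇒ `curl V ≡ 0` on `(−∞, τ] × ℝ³`.
[cite: KochNadirashviliSereginSverak2009, Prop. 4.1 and Lemma 3.1 (arXiv:0709.3599)] -/
theorem curl_eq_zero_until_of_subsolution_until_of_law {a K : ℝ} (ha : a ≤ 1) (hV : IsTypeIAncientMild C V)
    (hlawV : ∀ s : ℝ, s < 0 → ∫⁻ x, ‖fderiv ℝ (V s) x‖ₑ ^ 2 ≤ ENNReal.ofReal (K / Real.sqrt (-s)))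
    {τ : ℝ} (hτ : τ < 0)
    (hP : ∀ s : ℝ, s ≤ τ → ∀ y, (-s) * (⟪curl (V s) y, fderiv ℝ (V s) y (curl (V s) y)⟫_ℝ
        - a * frobeniusNormSq (fderiv ℝ (curl (V s)) y)) ≤ ⟪curl (V s) y, curl (V s) y⟫_ℝ) :
    ∀ s : ℝ, s ≤ τ → ∀ y, curl (V s) y = 0 := by
  -- adapted from `curl_eq_zero_until_of_critProdCredit_until` (p718968) and `eq_zero_of_enstrophy_subsolution_of_law` (p719134)
  intro s₀ hs₀ y₀
  by_contra hne
  have hs₀0 : s₀ < 0 := lt_of_le_of_lt hs₀ hτ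
  have hrate : HasTypeITimeDecay C V := hV.hasTypeITimeDecay
  have hcont : ContinuousOn (uncurry V) (Iio (0 : ℝ) ×ˢ univ) := hV.continuousOn_uncurry
  have hmild : ∀ s t : ℝ, s < t → t < 0 → ∀ x,
      V t x = UnboundedOperators.heatExtension (V s) (t - s) x - oseenDuhamel 1 s V V t x :=
    fun s t hst ht x => hV.mild_eq_heatExtension hst ht x
  -- ## the scale-invariant enstrophy and its supremum over `t ≤ τ`
  set E : ℝ → EuclideanSpace ℝ (Fin 3) → ℝ := fun t x => (-t) ^ 2 * ⟪curl (V t) x, curl (V t) x⟫_ℝ with hEdef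
  obtain ⟨C₂, hC₂⟩ := exists_curl_rate_of_class hrate hcont hmild
  have hEle : ∀ t < 0, ∀ x, E t x ≤ C₂ ^ 2 := by
    intro t ht x
    have h1 : ‖curl (V t) x‖ ≤ C₂ / (-t) := hC₂ t ht x
    have h2 : (-t) * ‖curl (V t) x‖ ≤ C₂ := by
      rw [le_div_iff₀ (neg_pos.2 ht)] at h1; linarith
    have h3 : 0 ≤ (-t) * ‖curl (V t) x‖ := mul_nonneg (neg_pos.2 ht).le (norm_nonneg _)
    simp only [hEdef, real_inner_self_eq_norm_sq]
    nlinarith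
  set S : Set ℝ := {m | ∃ t : ℝ, t ≤ τ ∧ ∃ x, m = E t x} with hSdef
  have hSbdd : BddAbove S :=
    ⟨C₂ ^ 2, by rintro m ⟨t, ht, x, rfl⟩; exact hEle t (lt_of_le_of_lt ht hτ) x⟩
  have hS0 : E s₀ y₀ ∈ S := ⟨s₀, hs₀, y₀, rfl⟩
  set M : ℝ := sSup S with hMdef
  have hEM : ∀ t : ℝ, t ≤ τ → ∀ x, E t x ≤ M := fun t ht x => le_csSup hSbdd ⟨t, ht, x, rfl⟩
  have hE0pos : 0 < E s₀ y₀ := by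
    simp only [hEdef, real_inner_self_eq_norm_sq]
    exact mul_pos (pow_pos (neg_pos.2 hs₀0) 2) (pow_pos (norm_pos_iff.2 hne) 2)
  have hMpos : 0 < M := hE0pos.trans_le (hEM s₀ hs₀ y₀)
  -- ## near-maximal points in the region
  have hpts : ∀ k : ℕ, ∃ t : ℝ, t ≤ τ ∧ ∃ x : EuclideanSpace ℝ (Fin 3), M - 1 / ((k : ℝ) + 1) < E t x := by
    intro k
    have hlt : M - 1 / ((k : ℝ) + 1) < sSup S := by
      have : (0 : ℝ) < 1 / ((k : ℝ) + 1) := by positivity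
      rw [hMdef]; linarith
    obtain ⟨m, ⟨t, ht, x, rfl⟩, hm⟩ := exists_lt_of_lt_csSup ⟨_, hS0⟩ hlt
    exact ⟨t, ht, x, hm⟩
  choose tk htk xk hxk using hpts
  have htk0 : ∀ k, tk k < 0 := fun k => lt_of_le_of_lt (htk k) hτ
  -- ## renormalisation to the hot spot `(−1, 0)`; `t ≤ −1` is mapped INTO `t ≤ τ`
  set vk : ℕ → ℝ → EuclideanSpace ℝ (Fin 3) → EuclideanSpace ℝ (Fin 3) := fun k =>
    nsRescale (Real.sqrt (-tk k)) (fun t x => V t (xk k + x)) with hvk_def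
  have hck : ∀ k, 0 < Real.sqrt (-tk k) := fun k => Real.sqrt_pos.2 (neg_pos.2 (htk0 k))
  have hck2 : ∀ k, Real.sqrt (-tk k) ^ 2 = -tk k := fun k => Real.sq_sqrt (neg_pos.2 (htk0 k)).le
  have hvk : ∀ k, IsTypeIAncientMild C (vk k) := fun k =>
    isTypeIAncientMild_nsRescale (isTypeIAncientMild_translate hV (xk k)) (hck k)
  have hlawvk : ∀ k, ∀ s : ℝ, s < 0 →
      ∫⁻ x, ‖fderiv ℝ (vk k s) x‖ₑ ^ 2 ≤ ENNReal.ofReal (K / Real.sqrt (-s)) := fun k => by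
    simp only [hvk_def]
    exact dissipationLaw_nsRescale (dissipationLaw_translate hlawV (xk k)) (hck k)
  have hreg : ∀ k, ∀ t : ℝ, t ≤ -1 → Real.sqrt (-tk k) ^ 2 * t ≤ τ := by
    intro k t ht
    rw [hck2]
    nlinarith [htk k, htk0 k, ht]
  have hvkP : ∀ k, ∀ s : ℝ, s ≤ -1 → ∀ y, (-s) * (⟪curl (vk k s) y, fderiv ℝ (vk k s) y (curl (vk k s) y)⟫_ℝ
      - a * frobeniusNormSq (fderiv ℝ (curl (vk k s)) y)) ≤ ⟪curl (vk k s) y, curl (vk k s) y⟫_ℝ := by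
    intro k s hs y
    simp only [hvk_def]
    exact critProdCredit_nsRescale_at (hck k)
      (critProdCredit_translate_at (u := V) (xk k) (hP _ (hreg k s hs) _))
  -- the scale-invariant enstrophy of `vk k` is that of `V` at the moved point
  have hEvk : ∀ k, ∀ t < 0, ∀ x, (-t) ^ 2 * ⟪curl (vk k t) x, curl (vk k t) x⟫_ℝ =
      E (Real.sqrt (-tk k) ^ 2 * t) (xk k + Real.sqrt (-tk k) • x) := by
    intro k t ht x
    simp only [hvk_def, hEdef]
    exact critEnstrophy_nsRescale_translate _ _ _ _ _
  have hEvk_le : ∀ k, ∀ t : ℝ, t ≤ -1 → ∀ x, (-t) ^ 2 * ⟪curl (vk k t) x, curl (vk k t) x⟫_ℝ ≤ M := by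
    intro k t ht x
    rw [hEvk k t (by linarith) x]
    exact hEM _ (hreg k t ht) _
  have hEvk_one : ∀ k, ⟪curl (vk k (-1)) 0, curl (vk k (-1)) 0⟫_ℝ = E (tk k) (xk k) := by
    intro k
    have h := hEvk k (-1) (by norm_num) 0
    rw [hck2, smul_zero, add_zero] at h
    have e : -tk k * (-1 : ℝ) = tk k := by ring
    rw [e] at h
    simpa using h
  -- ## extraction of a KNSS limit (uniform on slab pieces: second derivatives converge too)
  obtain ⟨φ, hφ, W, hW, hunif, hpt, hgrad⟩ := Compactness.seqLimit hvk
  have hlawW : ∀ s : ℝ, s < 0 → ∫⁻ x, ‖fderiv ℝ (W s) x‖ₑ ^ 2 ≤ ENNReal.ofReal (K / Real.sqrt (-s)) :=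
    dissipationLaw_of_tendsto_fderiv (fun j => hlawvk (φ j)) hgrad
  have hPW : ∀ s : ℝ, s ≤ -1 → ∀ y, (-s) * (⟪curl (W s) y, fderiv ℝ (W s) y (curl (W s) y)⟫_ℝ
      - a * frobeniusNormSq (fderiv ℝ (curl (W s)) y)) ≤ ⟪curl (W s) y, curl (W s) y⟫_ℝ :=
    fun s hs y => critProdCredit_of_limit_at (fun j => hvk (φ j)) hW hunif hgrad (by linarith) y
      (Eventually.of_forall fun j => hvkP (φ j) s hs y)
  have hconv : ∀ t < 0, ∀ x, Tendsto (fun j => ⟪curl (vk (φ j) t) x, curl (vk (φ j) t) x⟫_ℝ) atTop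
      (𝓝 ⟪curl (W t) x, curl (W t) x⟫_ℝ) := by
    intro t ht x
    have hc := tendsto_curl_of_fderiv (hgrad t ht x)
    exact hc.inner hc
  have hle : ∀ t : ℝ, t ≤ -1 → ∀ x, (-t) ^ 2 * ⟪curl (W t) x, curl (W t) x⟫_ℝ ≤ M := by
    intro t ht x
    have h := (hconv t (by linarith) x).const_mul ((-t) ^ 2)
    exact le_of_tendsto' h fun j => hEvk_le (φ j) t ht x
  have hmax : ⟪curl (W (-1)) 0, curl (W (-1)) 0⟫_ℝ = M := by
    have h1 := hconv (-1) (by norm_num) 0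
    have hεj : Tendsto (fun j : ℕ => M - 1 / ((φ j : ℝ) + 1)) atTop (𝓝 M) := by
      have h0 : Tendsto (fun j : ℕ => 1 / ((φ j : ℝ) + 1)) atTop (𝓝 0) := by
        have ha : Tendsto (fun j : ℕ => (φ j : ℝ) + 1) atTop atTop := by
          refine tendsto_atTop_add_const_right _ 1 ?_
          exact tendsto_natCast_atTop_atTop.comp hφ.tendsto_atTop
        refine (tendsto_inv_atTop_zero.comp ha).congr fun j => ?_
        simp [one_div, Function.comp]
      simpa using (tendsto_const_nhds (x := M)).sub h0
    have h2 : Tendsto (fun j => ⟪curl (vk (φ j) (-1)) 0, curl (vk (φ j) (-1)) 0⟫_ℝ) atTop (𝓝 M) := by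
      refine tendsto_of_tendsto_of_tendsto_of_le_of_le hεj tendsto_const_nhds (fun j => ?_) (fun j => ?_)
      · rw [hEvk_one]; exact (hxk (φ j)).le
      · rw [hEvk_one]; exact hEM _ (htk (φ j)) _
    exact tendsto_nhds_unique h1 h2
  -- ## the strong maximum principle on the slab `[−2, −1] × ℝ³` (maximum at the top): `Q ≡ M` below
  have hWrate : HasTypeITimeDecay C W := hW.hasTypeITimeDecay
  have hWcont : ContinuousOn (uncurry W) (Iio (0 : ℝ) ×ˢ univ) := hW.continuousOn_uncurry
  have hWmild : ∀ s t : ℝ, s < t → t < 0 → ∀ x,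
      W t x = UnboundedOperators.heatExtension (W s) (t - s) x - oseenDuhamel 1 s W W t x :=
    fun s t hst ht x => hW.mild_eq_heatExtension hst ht x
  have hWdiv : ∀ t < 0, VectorCalculus.IsDivFree (W t) := fun t ht => hW.isDivFree ht
  -- ## `Q = t² |ω|²` is a sub-solution on the slab `[−2, −1/2] × ℝ³`
  set q : ℝ → EuclideanSpace ℝ (Fin 3) → ℝ := fun τ y => ⟪curl (W τ) y, curl (W τ) y⟫_ℝ with hqdef
  set Q : ℝ → EuclideanSpace ℝ (Fin 3) → ℝ := fun τ y => τ ^ 2 * q τ y with hQdef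
  set Qt : ℝ → EuclideanSpace ℝ (Fin 3) → ℝ := fun τ y => deriv (fun τ' => Q τ' y) τ with hQtdef
  have hg : ∀ τ < (0 : ℝ), HasDerivAt (fun τ : ℝ => τ ^ 2) (2 * τ) τ := fun τ _ => by
    simpa using hasDerivAt_pow 2 τ
  have hid := fun τ (hτ : τ < 0) y => weightedEnstrophy_identity hWrate hWcont hWmild hWdiv hg hτ y
  have hslab : ∀ t ∈ Icc (-2 : ℝ) (-1), t < 0 := fun t ht => by linarith [ht.2]
  obtain ⟨B, hB⟩ := bdd_of_hasTypeITimeDecay hWrate (1 / 4) (by norm_num)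
  have hbA : ∀ t ∈ Icc (-2 : ℝ) (-1), ∀ x, ‖W t x‖ ≤ B := fun t ht x => hB t (by linarith [ht.2]) x
  have hsmω : IsSmoothSpaceTimeOn (Iio 0) (vorticity W) :=
    (show IsSmoothSpaceTimeOn (Iio 0) W from hW.contDiffOn).isSmoothSpaceTimeOn_vorticity isOpen_Iio.uniqueDiffOn
  have hq_c : ContinuousOn (uncurry q) (Icc (-2 : ℝ) (-1) ×ˢ univ) := by
    have hωc : ContinuousOn (uncurry (vorticity W)) (Icc (-2 : ℝ) (-1) ×ˢ univ) :=
      hsmω.continuousOn.mono (prod_mono (fun t ht => hslab t ht) Subset.rfl)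
    have h : ContinuousOn (fun z => ⟪uncurry (vorticity W) z, uncurry (vorticity W) z⟫_ℝ)
        (Icc (-2 : ℝ) (-1) ×ˢ univ) := hωc.inner hωc
    refine h.congr fun z _ => ?_
    simp only [hqdef, uncurry, vorticity_apply]
  have hQ_c : ContinuousOn (uncurry Q) (Icc (-2 : ℝ) (-1) ×ˢ univ) := by
    have hg1 : ContinuousOn (fun z : ℝ × EuclideanSpace ℝ (Fin 3) => z.1 ^ 2) (Icc (-2 : ℝ) (-1) ×ˢ univ) :=
      (continuous_fst.pow 2).continuousOn
    refine (hg1.mul hq_c).congr fun z _ => ?_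
    rcases z with ⟨a, b⟩
    rfl
  have hq2 : ∀ t < (0 : ℝ), ContDiff ℝ 2 (q t) := fun t ht => by
    have hΩ : ContDiff ℝ 2 (curl (W t)) :=
      contDiff_curl (n := 2) (analyticOnNhd_slice hWcont (bdd_of_hasTypeITimeDecay hWrate) hWmild ht).contDiff
    exact hΩ.inner ℝ hΩ
  have hQ2 : ∀ t ∈ Icc (-2 : ℝ) (-1), ContDiff ℝ 2 (Q t) := fun t ht => by
    have h : ContDiff ℝ 2 (fun y => t ^ 2 * q t y) := contDiff_const.mul (hq2 t (hslab t ht))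
    exact h
  have hQt : ∀ x, ∀ t ∈ Icc (-2 : ℝ) (-1), HasDerivAt (fun τ => Q τ x) (Qt t x) t :=
    fun x t ht => (hid t (hslab t ht) x).1
  have hlaw : ∀ t ∈ Icc (-2 : ℝ) (-1), ∀ x,
      Qt t x + fderiv ℝ (Q t) x (W t x) - (Δ (Q t)) x ≤ 0 := by
    intro t ht x
    have htn : t < 0 := hslab t ht
    have h := (hid t htn x).2
    have hP := hPW t ht.2 x
    have h1 : t ^ 2 * ⟪curl (W t) x, fderiv ℝ (W t) x (curl (W t) x)⟫_ℝ
        - a * t ^ 2 * frobeniusNormSq (fderiv ℝ (curl (W t)) x) ≤ (-t) * q t x := by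
      have h2 := mul_le_mul_of_nonneg_left hP (neg_pos.2 htn).le
      simp only [hqdef]
      nlinarith [h2]
    have hnn : 0 ≤ (1 - a) * t ^ 2 * frobeniusNormSq (fderiv ℝ (curl (W t)) x) :=
      mul_nonneg (mul_nonneg (sub_nonneg.2 ha) (sq_nonneg t)) (frobeniusNormSq_nonneg _)
    simp only [hQtdef, hQdef, hqdef] at h h1 ⊢
    rw [h]
    nlinarith [h1, hnn]
  have hle' : ∀ t ∈ Icc (-2 : ℝ) (-1), ∀ x, Q t x ≤ M := fun t ht x => by
    have h := hle t ht.2 x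
    rw [neg_sq] at h
    exact h
  have hmaxQ : Q (-1) 0 = M := by
    simp only [hQdef, hqdef, hmax]
    norm_num
  have hts : (-1 : ℝ) ∈ Ioc (-2 : ℝ) (-1) := by constructor <;> norm_num
  -- ## strong maximum principle: `Q ≡ M` on `[−2, −1) × ℝ³`
  have hS := strongMaximumPrinciple (t₀ := (-2 : ℝ)) (T := -1) hbA hQ_c hQ2 hQt hlaw hle' hts hmaxQ
  -- ## the slice `t = −3/2`: `|curl W|² ≡ 4M/9 > 0`, infinite dissipation
  have hs₁ : (-3 / 2 : ℝ) ∈ Ico (-2 : ℝ) (-1) := by constructor <;> norm_num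
  have hq₁ : ∀ x, q (-3 / 2) x = M / (-3 / 2) ^ 2 := by
    intro x
    have h := hS (-3 / 2) hs₁ x
    simp only [hQdef] at h
    rw [eq_div_iff (by norm_num)]
    linarith [h]
  have hq₁pos : 0 < M / (-3 / 2 : ℝ) ^ 2 := by positivity
  -- the pointwise lower bound on `‖∇W‖²`
  set κ : ℝ := ‖(curlCLM : (EuclideanSpace ℝ (Fin 3) →L[ℝ] EuclideanSpace ℝ (Fin 3)) →L[ℝ]
    EuclideanSpace ℝ (Fin 3))‖ with hκ
  have hκcurl : ∀ x, ‖curl (W (-3 / 2)) x‖ ≤ κ * ‖fderiv ℝ (W (-3 / 2)) x‖ := fun x => by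
    rw [curl_eq_curlCLM]; exact curlCLM.le_opNorm _
  have hκpos : 0 < κ := by
    by_contra hk
    have hk0 : κ ≤ 0 := not_lt.1 hk
    have h0 : ‖curl (W (-3 / 2)) 0‖ ≤ 0 :=
      (hκcurl 0).trans (mul_nonpos_of_nonpos_of_nonneg hk0 (norm_nonneg _))
    have hc : curl (W (-3 / 2)) 0 = 0 := norm_le_zero_iff.1 h0
    have h := hq₁ 0
    simp only [hqdef, hc, inner_zero_left] at h
    linarith [hq₁pos]
  set c₀ : ℝ := M / (-3 / 2 : ℝ) ^ 2 / κ ^ 2 with hc₀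
  have hc₀pos : 0 < c₀ := by positivity
  have hlow : ∀ x, ENNReal.ofReal c₀ ≤ ‖fderiv ℝ (W (-3 / 2)) x‖ₑ ^ 2 := by
    intro x
    have h1 : ‖curl (W (-3 / 2)) x‖ ^ 2 = M / (-3 / 2 : ℝ) ^ 2 := by
      rw [← real_inner_self_eq_norm_sq]; exact hq₁ x
    have h2 : ‖curl (W (-3 / 2)) x‖ ^ 2 ≤ κ ^ 2 * ‖fderiv ℝ (W (-3 / 2)) x‖ ^ 2 := by
      have h := hκcurl x
      have h0 : 0 ≤ ‖curl (W (-3 / 2)) x‖ := norm_nonneg _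
      nlinarith [h, h0]
    have h3 : c₀ ≤ ‖fderiv ℝ (W (-3 / 2)) x‖ ^ 2 := by
      rw [hc₀, div_le_iff₀ (pow_pos hκpos 2)]
      nlinarith [h1, h2]
    calc ENNReal.ofReal c₀ ≤ ENNReal.ofReal (‖fderiv ℝ (W (-3 / 2)) x‖ ^ 2) := ENNReal.ofReal_le_ofReal h3
      _ = ‖fderiv ℝ (W (-3 / 2)) x‖ₑ ^ 2 := by
          rw [← ofReal_norm, ← ENNReal.ofReal_pow (norm_nonneg _)]
  have hinf : ∫⁻ x, ‖fderiv ℝ (W (-3 / 2)) x‖ₑ ^ 2 = ⊤ := by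
    refine eq_top_iff.2 ?_
    calc (⊤ : ℝ≥0∞) = ∫⁻ _ : EuclideanSpace ℝ (Fin 3), ENNReal.ofReal c₀ := by
          rw [lintegral_const, measure_univ_of_isAddLeftInvariant,
            ENNReal.mul_top (ENNReal.ofReal_pos.2 hc₀pos).ne']
      _ ≤ ∫⁻ x, ‖fderiv ℝ (W (-3 / 2)) x‖ₑ ^ 2 := lintegral_mono hlow
  have hfin := hlawW (-3 / 2) (by norm_num)
  rw [hinf, top_le_iff] at hfin
  exact ENNReal.ofReal_ne_top hfin

/-- **THE BORDERLINE ROW IN THE FAR PAST (finite dissipation).**  `a ≤ 1`, `IsTypeIAncientMild C V`, the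
dissipation law, and `(−s)(⟪ω, DV ω⟫ − a|∇ω|²_F) ≤ |ω|²` on `(−∞, τ] × ℝ³` for some `τ < 0` ⇒ `V ≡ 0` on `t < 0`.
[cite: KochNadirashviliSereginSverak2009, Lemma 3.1, Prop. 4.1 and Remark 6.1 (arXiv:0709.3599)] -/
theorem eq_zero_of_enstrophy_subsolution_farPast_of_law {a K : ℝ} (ha : a ≤ 1) (hV : IsTypeIAncientMild C V)
    (hlawV : ∀ s : ℝ, s < 0 → ∫⁻ x, ‖fderiv ℝ (V s) x‖ₑ ^ 2 ≤ ENNReal.ofReal (K / Real.sqrt (-s)))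
    {τ : ℝ} (hτ : τ < 0)
    (hP : ∀ s : ℝ, s ≤ τ → ∀ y, (-s) * (⟪curl (V s) y, fderiv ℝ (V s) y (curl (V s) y)⟫_ℝ
        - a * frobeniusNormSq (fderiv ℝ (curl (V s)) y)) ≤ ⟪curl (V s) y, curl (V s) y⟫_ℝ) :
    ∀ t < 0, ∀ x, V t x = 0 := by
  have hcurl := curl_eq_zero_until_of_subsolution_until_of_law ha hV hlawV hτ hP
  have hconst : ∀ t : ℝ, t ≤ τ → ∀ x, V t x = V t 0 := fun t ht x =>
    eq_of_curl_eq_zero_of_isDivFree_of_bounded ((hV.contDiff_slice (lt_of_le_of_lt ht hτ)).of_le (by norm_cast))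
      (hcurl t ht) (hV.isDivFree (lt_of_le_of_lt ht hτ)) (fun z => hV.norm_le (lt_of_le_of_lt ht hτ) z) x 0
  exact eq_zero_of_const_slices_until hV hτ hconst

/-- **PORTRAIT: the super-caloric points of `t²|ω|²` recede into the far past.**  A finite-dissipation KNSS-gauge
Type-I field not identically zero on `t < 0` has, for every `a ≤ 1` and every `τ < 0`, a point `(s, y)` with
`s ≤ τ` and `|ω(s,y)|² < (−s)(⟪ω, DV ω⟫ − a|∇ω|²_F)(s, y)`. [cite: KochNadirashviliSereginSverak2009, Prop. 4.1 (arXiv:0709.3599)] -/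
theorem subsolution_fails_farPast_of_ne_zero {a K : ℝ} (ha : a ≤ 1) (hV : IsTypeIAncientMild C V)
    (hlawV : ∀ s : ℝ, s < 0 → ∫⁻ x, ‖fderiv ℝ (V s) x‖ₑ ^ 2 ≤ ENNReal.ofReal (K / Real.sqrt (-s)))
    (hne : ∃ t : ℝ, t < 0 ∧ ∃ x, V t x ≠ 0) {τ : ℝ} (hτ : τ < 0) :
    ∃ s : ℝ, s ≤ τ ∧ ∃ y : EuclideanSpace ℝ (Fin 3),
      ⟪curl (V s) y, curl (V s) y⟫_ℝ < (-s) * (⟪curl (V s) y, fderiv ℝ (V s) y (curl (V s) y)⟫_ℝ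
        - a * frobeniusNormSq (fderiv ℝ (curl (V s)) y)) := by
  by_contra h
  push Not at h
  obtain ⟨t, ht, x, hx⟩ := hne
  exact hx (eq_zero_of_enstrophy_subsolution_farPast_of_law ha hV hlawV hτ (fun s hs y => h s hs y) t ht x)

end Summit.NavierStokesRegularity.NavierStokesRegularity.Theorems.FiniteDissipationLiouville.CriticalProduction

end
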